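import Literature.NumberTheory.LFunctions.DobnerNewman
import Literature.NumberTheory.LFunctions.DeBruijnHSimpleZerosProofs
import Literature.NumberTheory.LFunctions.RiemannXiOrderProofs
import Literature.NumberTheory.LFunctions.MertensBoundRH
import Mathlib.MeasureTheory.Measure.Haar.NormedSpace
import HarnessLib

/-!
# Dobner's steepest descent: the integrals `B_{t,n}(s)` and Lemma 4 (named fact)

Trunk T-ANT (`Literature/NumberTheory/LFunctions`). Definitions and named facts (D-0014) for §4 of

> A. Dobner, *A proof of Newman's conjecture for the extended Selberg class*, Acta Arith. 201
> (2021), 29–62 = arXiv:2005.05142 (held),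

for `F = ζ`, continuing `DobnerNewman.lean`. After `DobnerNewmanProofs.lean` (§3.1),
`DobnerLemma3Proofs.lean` (Lemma 3) and `BohrAlmostPeriodicProofs.lean` (Bohr's theorem), the only
named fact left on Dobner's route to `Literature.NumberTheory.LFunctions.rodgers_tao` (`Λ ≥ 0`) is the qualitative Thm. 4,
`Literature.NumberTheory.LFunctions.dobner_xiDeformed_approx`. §4 of the source derives Thm. 4 from **Lemma 4** (three-regime
estimates for the integrals `B_{t,n}(s)` on the line `Re z = 2`, proved by the method of steepest
descent from Stirling's formula, Lemmas 5–7) by a summation argument (§4.1, proved in the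
companion file `DobnerTheorem4Proofs.lean`). This file supplies:

* `Literature.NumberTheory.LFunctions.xiDeformed_eq_integral_riemannXi` — **eq. (3.1)** on the vertical line through `s`:
  `ξ_t(s) = (π|t|)^{-1/2} ∫_ℝ ξ(s + iu) e^{−u²/|t|} du`, **proved** from the Gaussian smoothing
  identity `Literature.NumberTheory.LFunctions.deBruijnH_sub_sq_eq_integral` (`DeBruijnHSimpleZerosProofs.lean`);
* `Literature.NumberTheory.LFunctions.xiDeformed_eq_integral_riemannXi_two` — **eq. (3.1) as printed, on the line `Re w = 2`**:
  `ξ_t(s) = (π|t|)^{-1/2} ∫_ℝ ξ(2 + iv) e^{(s − 2 − iv)²/|t|} dv`, **proved** by shifting the line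
  of integration (`Literature.NumberTheory.LFunctions.MertensBoundRH.integral_vertical_eq_of_tendsto`; the Gaussian factor beats
  the order-one growth of `ξ`, `Literature.NumberTheory.LFunctions.riemannXi_order_le_one_holds`);
* `Literature.dobnerB t n s` — the integral `B_{t,n}(s)` of **eq. (4.1)** on the source's line `Re z = 2`,
  and `Literature.dobnerMainTerm t n s = γ_t(s) e^{−(|t|/4) log² n} n^{−s}`;
* `Literature.NumberTheory.LFunctions.xiDeformed_dobnerJ_eq_tsum_dobnerB` — `ξ_t(J_t(s)) = Σ_{n ≥ 1} B_{t,n}(s)` for every `s`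
  (§4, first display: insert `ξ = γ ζ = γ Σ n^{-z}` on `Re z = 2` and interchange), **proved**;
* `Literature.NumberTheory.LFunctions.dobner_lemma4` — NAMED FACT, **Lemma 4** of the source for `F = ζ` (`a_n = 1`).

The companion `DobnerTheorem4Proofs.lean` proves the qualitative Thm. 4 from `dobner_lemma4` alone
(the lower bound `|γ_t(s)| ≫ e^{−K'y}` of eq. (4.9), which the source takes from its Lemma 1, is
proved there elementarily on vertical strips), whence `Literature.RH.rodgers_tao_of_dobner_lemma4 :
dobner_lemma4 → RH.rodgers_tao`.

(An earlier draft took `B_{t,n}` on the line through `J_t(s)`; as pointed out in review, in Lemma 4's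
region `|Re s| ≤ C (Im s)^{1/4}` the real part of `J_t(s)` is unbounded below, that line crosses
the poles `−2, −4, …` of `γ`, and Lemma 4 would be false for that object. The definition below is
the source's.)

## References

* A. Dobner, op. cit., §3 eq. (3.1), §4 eq. (4.1), Lemma 4, §4.1.
* E. C. Titchmarsh, *The Theory of the Riemann Zeta-Function*, 2nd ed., Thm. 2.12 (order of `ξ`).
-/

noncomputable section

open Complex Filter Set Topology MeasureTheory

namespace Literature.NumberTheory.LFunctions

/-! ## Eq. (3.1): `ξ_t` as a Gaussian average of `ξ` on a vertical line -/

/-- **Dobner's Gaussian-convolution formula for `ξ_t`** (eq. (3.1) of the source, on the vertical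
line through `s` itself): for `t < 0`,
`ξ_t(s) = (π|t|)^{-1/2} ∫_ℝ ξ(s + iu) e^{−u²/|t|} du = (1/(i√(π|t|))) ∫_{Re w = Re s} ξ(w) e^{(s−w)²/|t|} dw`.
From the Gaussian smoothing identity `Literature.NumberTheory.LFunctions.deBruijnH_sub_sq_eq_integral` (`t₀ = 0`, `σ = √|t|`),
`ξ_t(w) = 8 H_t(−i(2w−1))`, `H_0 = ξ(½ + iz/2)/8` and the substitution `u = σ r/2`.
[cite: Dobner2021, §3 eq. (3.1)] -/
theorem xiDeformed_eq_integral_riemannXi {t : ℝ} (ht : t < 0) (s : ℂ) :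
    xiDeformed t s = ((1 / Real.sqrt (Real.pi * |t|) : ℝ) : ℂ) *
      ∫ u : ℝ, riemannXi (s + u * I) * (Real.exp (-(u ^ 2 / |t|)) : ℂ) := by
  set σ : ℝ := Real.sqrt (-t) with hσ
  have hσ0 : 0 < σ := Real.sqrt_pos.2 (by linarith)
  have hσ2 : σ ^ 2 = -t := Real.sq_sqrt (by linarith)
  have habs : |t| = σ ^ 2 := by rw [hσ2, abs_of_neg ht]
  have ht' : 0 - σ ^ 2 = t := by linarith
  -- Gaussian smoothing at `t₀ = 0`
  have hG := deBruijnH_sub_sq_eq_integral 0 σ (-I * (2 * s - 1))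
  rw [ht'] at hG
  rw [xiDeformed, hG, four_pi_cpow_half_eq]
  -- identify `H_0(z + σ r)` with `ξ(s + iσr/2)/8`
  have hH0 : ∀ r : ℝ, deBruijnH 0 (-I * (2 * s - 1) + σ * r) =
      riemannXi (s + ((σ / 2 * r : ℝ) : ℂ) * I) / 8 := by
    intro r
    rw [deBruijnH_zero_eq_holds]
    congr 2
    push_cast
    ring_nf
    rw [Complex.I_sq]
    ring
  simp_rw [hH0]
  -- substitution `u = (σ/2) r`
  set g : ℝ → ℂ := fun u ↦ riemannXi (s + u * I) * (Real.exp (-(u ^ 2 / |t|)) : ℂ) with hg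
  have hsub : (fun r : ℝ ↦ cexp (-(r : ℂ) ^ 2 / 4) * (riemannXi (s + ((σ / 2 * r : ℝ) : ℂ) * I) / 8)) =
      fun r : ℝ ↦ (1 / 8 : ℂ) * g (σ / 2 * r) := by
    funext r
    simp only [hg]
    rw [cexp_neg_sq_quarter_eq]
    have e : -(1 / 4) * r ^ 2 = -((σ / 2 * r) ^ 2 / |t|) := by
      rw [habs]; field_simp; ring
    rw [e]
    ring
  rw [hsub, integral_const_mul, Measure.integral_comp_mul_left g (σ / 2)]
  -- constants
  have hsq4 : Real.sqrt (4 * Real.pi) = 2 * Real.sqrt Real.pi := by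
    rw [Real.sqrt_mul (by norm_num : (0 : ℝ) ≤ 4), show Real.sqrt 4 = 2 by
      rw [show (4 : ℝ) = 2 ^ 2 by norm_num, Real.sqrt_sq (by norm_num)]]
  have hsqt : Real.sqrt (Real.pi * |t|) = Real.sqrt Real.pi * σ := by
    rw [Real.sqrt_mul Real.pi_pos.le, habs, Real.sqrt_sq hσ0.le]
  have hπ : 0 < Real.sqrt Real.pi := Real.sqrt_pos.2 Real.pi_pos
  rw [abs_of_pos (by positivity : 0 < (σ / 2)⁻¹), hsq4, hsqt, Complex.real_smul, ← mul_assoc,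
    ← mul_assoc, ← mul_assoc]
  congr 1
  have hπ' : (Real.sqrt Real.pi : ℂ) ≠ 0 := by exact_mod_cast hπ.ne'
  have hσ' : (σ : ℂ) ≠ 0 := by exact_mod_cast hσ0.ne'
  push_cast
  field_simp


/-! ## `γ` on right half-planes -/

/-- A polynomial bound for `γ` on the vertical line `Re z = Re J > 0`:
`‖γ(J + iu)‖ ≤ π^{-Re J/2} Γ(Re J/2) (‖J‖ + 1 + |u|)²` (`|Γ(w)| ≤ Γ(Re w)`). [folklore] -/
theorem norm_xiGammaFactor_vertical_le {J : ℂ} (hJ : 0 < J.re) (u : ℝ) :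
    ‖xiGammaFactor (J + u * I)‖ ≤
      Real.pi ^ (-J.re / 2) * Real.Gamma (J.re / 2) * (‖J‖ + 1 + |u|) ^ 2 := by
  have hre : (J + u * I).re = J.re := by simp
  rw [xiGammaFactor, norm_mul, norm_div, norm_mul, Gammaℝ_def, norm_mul]
  have h1 : ‖J + u * I‖ ≤ ‖J‖ + |u| := by
    refine (norm_add_le _ _).trans ?_
    rw [norm_mul, Complex.norm_I, mul_one, Complex.norm_real, Real.norm_eq_abs]
  have h2 : ‖J + u * I - 1‖ ≤ ‖J‖ + 1 + |u| := by
    calc ‖J + u * I - 1‖ ≤ ‖J + u * I‖ + ‖(1 : ℂ)‖ := norm_sub_le _ _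
      _ ≤ ‖J‖ + |u| + 1 := by rw [norm_one]; linarith
      _ = ‖J‖ + 1 + |u| := by ring
  have h3 : ‖(Real.pi : ℂ) ^ (-(J + u * I) / 2)‖ = Real.pi ^ (-J.re / 2) := by
    rw [Complex.norm_cpow_eq_rpow_re_of_pos Real.pi_pos]
    congr 1
    simp
  have h4 : ‖Complex.Gamma ((J + u * I) / 2)‖ ≤ Real.Gamma (J.re / 2) := by
    have := norm_Gamma_le_Gamma_re (s := (J + u * I) / 2) (by simp; linarith)
    simpa using this
  have hpos : 0 ≤ Real.pi ^ (-J.re / 2) := Real.rpow_nonneg Real.pi_pos.le _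
  have hG0 : 0 ≤ Real.Gamma (J.re / 2) := (Real.Gamma_pos_of_pos (by linarith)).le
  rw [h3, Complex.norm_two]
  have hJ0 : 0 ≤ ‖J‖ := norm_nonneg _
  have hu0 : 0 ≤ |u| := abs_nonneg _
  calc ‖J + ↑u * I‖ * ‖J + ↑u * I - 1‖ / 2 * (Real.pi ^ (-J.re / 2) * ‖Complex.Gamma ((J + ↑u * I) / 2)‖)
      ≤ (‖J‖ + |u|) * (‖J‖ + 1 + |u|) / 2 * (Real.pi ^ (-J.re / 2) * Real.Gamma (J.re / 2)) := by
        gcongr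
    _ ≤ Real.pi ^ (-J.re / 2) * Real.Gamma (J.re / 2) * (‖J‖ + 1 + |u|) ^ 2 := by
        have : (‖J‖ + |u|) * (‖J‖ + 1 + |u|) / 2 ≤ (‖J‖ + 1 + |u|) ^ 2 := by nlinarith
        calc (‖J‖ + |u|) * (‖J‖ + 1 + |u|) / 2 * (Real.pi ^ (-J.re / 2) * Real.Gamma (J.re / 2))
            ≤ (‖J‖ + 1 + |u|) ^ 2 * (Real.pi ^ (-J.re / 2) * Real.Gamma (J.re / 2)) :=
              mul_le_mul_of_nonneg_right this (mul_nonneg hpos hG0)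
          _ = _ := by ring

/-- `(1 + |u|)^2 e^{−u²/b}` type functions are integrable: here `(K + |u|)² e^{−u²/|t|}`. [folklore] -/
theorem integrable_sq_mul_exp_neg_sq_div {K b : ℝ} (hb : 0 < b) :
    Integrable fun u : ℝ ↦ (K + |u|) ^ 2 * Real.exp (-(u ^ 2 / b)) := by
  have h0 : Integrable fun u : ℝ ↦ Real.exp (-b⁻¹ * u ^ 2) := integrable_exp_neg_mul_sq (by positivity)
  have h1 : Integrable fun u : ℝ ↦ u * Real.exp (-b⁻¹ * u ^ 2) := integrable_mul_exp_neg_mul_sq (by positivity)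
  have h2 : Integrable fun u : ℝ ↦ u ^ (2 : ℝ) * Real.exp (-b⁻¹ * u ^ 2) :=
    integrable_rpow_mul_exp_neg_mul_sq (by positivity) (by norm_num)
  have h1' : Integrable fun u : ℝ ↦ |u| * Real.exp (-b⁻¹ * u ^ 2) := by
    refine h1.norm.congr (Eventually.of_forall fun u ↦ ?_)
    simp [abs_of_pos (Real.exp_pos _)]
  have h2' : Integrable fun u : ℝ ↦ u ^ 2 * Real.exp (-b⁻¹ * u ^ 2) := by
    refine h2.congr (Eventually.of_forall fun u ↦ ?_)
    simp only
    rw [show (2 : ℝ) = ((2 : ℕ) : ℝ) by norm_num, Real.rpow_natCast]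
  have := ((h0.const_mul (K ^ 2)).add (h1'.const_mul (2 * K))).add h2'
  refine this.congr (Eventually.of_forall fun u ↦ ?_)
  simp only [Pi.add_apply]
  rw [show -(u ^ 2 / b) = -b⁻¹ * u ^ 2 by ring, ← sq_abs u]
  ring


/-! ## Eq. (3.1) on the line `Re w = 2`: shifting the line of integration -/

/-- **A Gaussian beats the order of `ξ`**: for a bounded range of abscissae `σ ∈ [a, b]`, real
`t ≠ 0` and complex `J`, `‖ξ(σ + iT) e^{(J − σ − iT)²/|t|}‖ ≤ C e^{−T²/(4|t|)}` with `C`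
independent of `σ` and `T` (`|ξ(w)| ≤ C₁ e^{A|w| log(1+|w|)}`, Titchmarsh Thm. 2.12, and
`log(1+x) ≤ 2√(1+x)`). [folklore] -/
theorem exists_norm_riemannXi_mul_gaussian_le {t : ℝ} (ht : t ≠ 0) (J : ℂ) (a b : ℝ) :
    ∃ C : ℝ, 0 < C ∧ ∀ σ ∈ Icc a b, ∀ T : ℝ,
      ‖riemannXi (σ + T * I) * Complex.exp (((1 / |t| : ℝ) : ℂ) * (J - (σ + T * I)) ^ 2)‖ ≤
        C * Real.exp (-(T ^ 2 / (4 * |t|))) := by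
  have ht' : 0 < |t| := abs_pos.2 ht
  obtain ⟨A, C₁, hA, hC₁, hξ⟩ := riemannXi_order_le_one_holds.nonneg
  set M : ℝ := max |a| |b| with hM
  have hM0 : 0 ≤ M := le_max_of_le_left (abs_nonneg a)
  -- the comparison function `φ(r) = 2A(M+r)(1+M+r)^{1/2} − r²/(4|t|)` is bounded above on `r ≥ 0`
  set φ : ℝ → ℝ := fun r ↦ 2 * A * (M + r) * (1 + M + r) ^ (1 / 2 : ℝ) - r ^ 2 / (4 * |t|) with hφ
  set R₁ : ℝ := max (1 + M) ((16 * Real.sqrt 3 * A * |t|) ^ 2 + 1) with hR₁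
  have hφneg : ∀ r : ℝ, R₁ ≤ r → φ r ≤ 0 := by
    intro r hr
    have hr1 : 1 + M ≤ r := (le_max_left _ _).trans hr
    have hr0 : 0 < r := by linarith
    have h3 : (1 + M + r) ^ (1 / 2 : ℝ) ≤ Real.sqrt 3 * r ^ (1 / 2 : ℝ) := by
      rw [Real.sqrt_eq_rpow, ← Real.mul_rpow (by norm_num) hr0.le]
      exact Real.rpow_le_rpow (by linarith) (by linarith) (by norm_num)
    have h4 : 2 * A * (M + r) * (1 + M + r) ^ (1 / 2 : ℝ) ≤ 4 * Real.sqrt 3 * A * (r * r ^ (1 / 2 : ℝ)) := by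
      have hMr : M + r ≤ 2 * r := by linarith
      have hA2 : 0 ≤ 2 * A := by positivity
      have hp0 : 0 ≤ (1 + M + r) ^ (1 / 2 : ℝ) := Real.rpow_nonneg (by linarith) _
      calc 2 * A * (M + r) * (1 + M + r) ^ (1 / 2 : ℝ)
          ≤ 2 * A * (2 * r) * (Real.sqrt 3 * r ^ (1 / 2 : ℝ)) :=
            mul_le_mul (mul_le_mul_of_nonneg_left hMr hA2) h3 hp0 (by positivity)
        _ = 4 * Real.sqrt 3 * A * (r * r ^ (1 / 2 : ℝ)) := by ring
    have h5 : 16 * Real.sqrt 3 * A * |t| ≤ r ^ (1 / 2 : ℝ) := by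
      have hr2 : (16 * Real.sqrt 3 * A * |t|) ^ 2 + 1 ≤ r := (le_max_right _ _).trans hr
      have hnn : 0 ≤ 16 * Real.sqrt 3 * A * |t| := by positivity
      calc 16 * Real.sqrt 3 * A * |t| = ((16 * Real.sqrt 3 * A * |t|) ^ 2) ^ (1 / 2 : ℝ) := by
            rw [← Real.sqrt_eq_rpow, Real.sqrt_sq hnn]
        _ ≤ r ^ (1 / 2 : ℝ) := Real.rpow_le_rpow (by positivity) (by linarith) (by norm_num)
    have h6 : r ^ 2 / (4 * |t|) = r * r ^ (1 / 2 : ℝ) * r ^ (1 / 2 : ℝ) / (4 * |t|) := by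
      rw [mul_assoc, ← Real.rpow_add hr0]; norm_num; ring
    simp only [hφ]
    rw [h6, sub_nonpos]
    calc 2 * A * (M + r) * (1 + M + r) ^ (1 / 2 : ℝ) ≤ 4 * Real.sqrt 3 * A * (r * r ^ (1 / 2 : ℝ)) := h4
      _ = r * r ^ (1 / 2 : ℝ) * (16 * Real.sqrt 3 * A * |t|) / (4 * |t|) := by field_simp; ring
      _ ≤ r * r ^ (1 / 2 : ℝ) * r ^ (1 / 2 : ℝ) / (4 * |t|) := by
          gcongr
  have hφc : ContinuousOn φ (Icc 0 R₁) := by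
    simp only [hφ]
    refine ContinuousOn.sub (ContinuousOn.mul (by fun_prop) ?_) (by fun_prop)
    exact ContinuousOn.rpow_const (by fun_prop) fun r hr ↦ Or.inl (by linarith [hr.1])
  obtain ⟨K₂, hK₂⟩ := (isCompact_Icc (a := (0 : ℝ)) (b := R₁)).bddAbove_image hφc
  have hφle : ∀ r : ℝ, 0 ≤ r → φ r ≤ max K₂ 0 := by
    intro r hr
    rcases le_or_gt r R₁ with h | h
    · exact (hK₂ ⟨r, ⟨hr, h⟩, rfl⟩).trans (le_max_left _ _)
    · exact (hφneg r h.le).trans (le_max_right _ _)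
  -- the constant
  set K₀ : ℝ := ((|J.re| + M) ^ 2 + J.im ^ 2) / |t| with hK₀
  refine ⟨C₁ * Real.exp (K₀ + max K₂ 0) + 1, by positivity, fun σ hσ T ↦ ?_⟩
  have hσM : |σ| ≤ M := by
    rw [hM]; rw [abs_le]
    obtain ⟨h1, h2⟩ := hσ
    constructor
    · linarith [neg_abs_le a, le_max_left |a| |b|]
    · linarith [le_abs_self b, le_max_right |a| |b|]
  set w : ℂ := σ + T * I with hw
  have hwn : ‖w‖ ≤ M + |T| := by
    calc ‖w‖ ≤ ‖(σ : ℂ)‖ + ‖(T : ℂ) * I‖ := norm_add_le _ _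
      _ = |σ| + |T| := by simp
      _ ≤ M + |T| := by linarith
  -- the `ξ` factor
  have hlog : Real.log (1 + ‖w‖) ≤ 2 * (1 + M + |T|) ^ (1 / 2 : ℝ) := by
    have h1 : Real.log (1 + ‖w‖) ≤ Real.log (1 + M + |T|) :=
      Real.log_le_log (by positivity) (by linarith)
    have h2 := Real.log_le_rpow_div (show (0 : ℝ) ≤ 1 + M + |T| by positivity) (by norm_num : (0 : ℝ) < 1 / 2)
    rw [div_eq_mul_inv, show ((1 : ℝ) / 2)⁻¹ = 2 by norm_num] at h2
    linarith
  have hξw : ‖riemannXi w‖ ≤ C₁ * Real.exp (2 * A * (M + |T|) * (1 + M + |T|) ^ (1 / 2 : ℝ)) := by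
    refine (hξ w).trans (mul_le_mul_of_nonneg_left (Real.exp_le_exp.2 ?_) hC₁)
    have : A * ‖w‖ * Real.log (1 + ‖w‖) ≤ A * (M + |T|) * (2 * (1 + M + |T|) ^ (1 / 2 : ℝ)) := by
      refine mul_le_mul (mul_le_mul_of_nonneg_left hwn hA) hlog (Real.log_nonneg (by linarith [norm_nonneg w])) (by positivity)
    linarith
  -- the Gaussian factor
  have hgauss : ‖Complex.exp (((1 / |t| : ℝ) : ℂ) * (J - w) ^ 2)‖ ≤
      Real.exp (K₀ - T ^ 2 / (2 * |t|)) := by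
    rw [Complex.norm_exp]
    apply Real.exp_le_exp.2
    have hre : ((((1 / |t| : ℝ) : ℂ) * (J - w) ^ 2).re) = ((J.re - σ) ^ 2 - (J.im - T) ^ 2) / |t| := by
      rw [Complex.re_ofReal_mul, sq, Complex.mul_re]
      simp [hw]
      ring
    rw [hre, hK₀]
    have h1 : (J.re - σ) ^ 2 ≤ (|J.re| + M) ^ 2 := by
      have : |J.re - σ| ≤ |J.re| + M := (abs_sub _ _).trans (by linarith)
      calc (J.re - σ) ^ 2 = |J.re - σ| ^ 2 := (sq_abs _).symm
        _ ≤ (|J.re| + M) ^ 2 := pow_le_pow_left₀ (abs_nonneg _) this 2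
    have h2 : T ^ 2 / 2 - J.im ^ 2 ≤ (J.im - T) ^ 2 := by nlinarith [sq_nonneg (2 * J.im - T)]
    rw [show ((|J.re| + M) ^ 2 + J.im ^ 2) / |t| - T ^ 2 / (2 * |t|) =
      ((|J.re| + M) ^ 2 + J.im ^ 2 - T ^ 2 / 2) / |t| by field_simp]
    exact div_le_div_of_nonneg_right (by linarith) ht'.le
  -- combine
  have hφT := hφle |T| (abs_nonneg T)
  simp only [hφ] at hφT
  have habs2 : |T| ^ 2 = T ^ 2 := sq_abs T
  rw [habs2] at hφT
  calc ‖riemannXi w * Complex.exp (((1 / |t| : ℝ) : ℂ) * (J - w) ^ 2)‖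
      = ‖riemannXi w‖ * ‖Complex.exp (((1 / |t| : ℝ) : ℂ) * (J - w) ^ 2)‖ := norm_mul _ _
    _ ≤ C₁ * Real.exp (2 * A * (M + |T|) * (1 + M + |T|) ^ (1 / 2 : ℝ)) *
        Real.exp (K₀ - T ^ 2 / (2 * |t|)) :=
        mul_le_mul hξw hgauss (norm_nonneg _) (by positivity)
    _ = C₁ * Real.exp (K₀ + (2 * A * (M + |T|) * (1 + M + |T|) ^ (1 / 2 : ℝ) - T ^ 2 / (4 * |t|))
        - T ^ 2 / (4 * |t|)) := by
        rw [mul_assoc, ← Real.exp_add]; congr 2; field_simp; ring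
    _ ≤ C₁ * Real.exp (K₀ + max K₂ 0 - T ^ 2 / (4 * |t|)) := by
        gcongr
    _ = C₁ * Real.exp (K₀ + max K₂ 0) * Real.exp (-(T ^ 2 / (4 * |t|))) := by
        rw [mul_assoc, ← Real.exp_add]; congr 2
    _ ≤ (C₁ * Real.exp (K₀ + max K₂ 0) + 1) * Real.exp (-(T ^ 2 / (4 * |t|))) := by
        gcongr; linarith

/-- The entire function `w ↦ ξ(w) e^{(s − w)²/|t|}` restricted to a vertical line is continuous.
[folklore] -/
theorem continuous_riemannXi_mul_gaussian_vertical (t : ℝ) (s : ℂ) (σ : ℝ) :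
    Continuous fun T : ℝ ↦ riemannXi (σ + T * I) *
      Complex.exp (((1 / |t| : ℝ) : ℂ) * (s - (σ + T * I)) ^ 2) := by
  have hξ : Continuous riemannXi := differentiable_riemannXi.continuous
  fun_prop

/-- `w ↦ ξ(w) e^{(s − w)²/|t|}` is integrable on every vertical line. [folklore] -/
theorem integrable_riemannXi_mul_gaussian_vertical {t : ℝ} (ht : t ≠ 0) (s : ℂ) (σ : ℝ) :
    Integrable fun T : ℝ ↦ riemannXi (σ + T * I) *
      Complex.exp (((1 / |t| : ℝ) : ℂ) * (s - (σ + T * I)) ^ 2) := by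
  have ht' : 0 < |t| := abs_pos.2 ht
  obtain ⟨C, hC, hle⟩ := exists_norm_riemannXi_mul_gaussian_le ht s σ σ
  have hg : Integrable fun T : ℝ ↦ C * Real.exp (-(1 / (4 * |t|)) * T ^ 2) :=
    (integrable_exp_neg_mul_sq (by positivity)).const_mul C
  refine hg.mono' (continuous_riemannXi_mul_gaussian_vertical t s σ).aestronglyMeasurable
    (Eventually.of_forall fun T ↦ ?_)
  have := hle σ ⟨le_rfl, le_rfl⟩ T
  rwa [show -(T ^ 2 / (4 * |t|)) = -(1 / (4 * |t|)) * T ^ 2 by ring] at this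

/-- **Eq. (3.1) of the source, on the line `Re w = 2`**: for `t < 0` and every `s`,
`ξ_t(s) = (π|t|)^{-1/2} ∫_ℝ ξ(2 + iv) e^{(s − 2 − iv)²/|t|} dv`
(`= (1/(i√(π|t|))) ∫_{2−i∞}^{2+i∞} ξ(w) e^{(s−w)²/|t|} dw`): the line of
`xiDeformed_eq_integral_riemannXi` (through `s`) is shifted to `Re w = 2` by Cauchy's theorem on
rectangles `[Re s, 2] × [−T, T]`, `T → ∞` (`Literature.NumberTheory.LFunctions.MertensBoundRH.integral_vertical_eq_of_tendsto`),
the horizontal edges tending to `0` because the Gaussian beats the order-one growth of `ξ`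
(`exists_norm_riemannXi_mul_gaussian_le`). [cite: Dobner2021, §3 eq. (3.1)] -/
theorem xiDeformed_eq_integral_riemannXi_two {t : ℝ} (ht : t < 0) (s : ℂ) :
    xiDeformed t s = ((1 / Real.sqrt (Real.pi * |t|) : ℝ) : ℂ) *
      ∫ v : ℝ, riemannXi (2 + v * I) * Complex.exp (((1 / |t| : ℝ) : ℂ) * (s - (2 + v * I)) ^ 2) := by
  have ht0 : t ≠ 0 := ht.ne
  have ht' : 0 < |t| := abs_pos.2 ht0
  set F : ℂ → ℂ := fun w ↦ riemannXi w * Complex.exp (((1 / |t| : ℝ) : ℂ) * (s - w) ^ 2) with hF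
  -- step 1: (3.1) through `s`, rewritten as a vertical-line integral of `F` on `Re w = Re s`
  have h1 : xiDeformed t s = ((1 / Real.sqrt (Real.pi * |t|) : ℝ) : ℂ) *
      ∫ v : ℝ, F (s.re + v * I) := by
    rw [xiDeformed_eq_integral_riemannXi ht s]
    congr 1
    have e : (fun u : ℝ ↦ riemannXi (s + u * I) * (Real.exp (-(u ^ 2 / |t|)) : ℂ)) =
        fun u : ℝ ↦ (fun v : ℝ ↦ F (s.re + v * I)) (u + s.im) := by
      funext u
      have hw : (s.re : ℂ) + ((u + s.im : ℝ) : ℂ) * I = s + u * I := by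
        apply Complex.ext <;> simp [add_comm]
      simp only [hF, hw]
      congr 1
      rw [Complex.ofReal_exp]
      congr 1
      rw [show s - (s + u * I) = -(u * I) by ring]
      push_cast
      rw [show (-((u : ℂ) * I)) ^ 2 = -(u : ℂ) ^ 2 by rw [neg_sq, mul_pow, Complex.I_sq]; ring]
      field_simp
    rw [e, integral_add_right_eq_self (fun v : ℝ ↦ F (s.re + v * I)) s.im]
  -- step 2: shift to `Re w = 2`
  have hFd : Differentiable ℂ F := by
    simp only [hF]
    exact differentiable_riemannXi.mul (by fun_prop)
  have hshift : ∀ a b : ℝ, a ≤ b → ∫ v : ℝ, F (a + v * I) = ∫ v : ℝ, F (b + v * I) := by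
    intro a b hab
    obtain ⟨C, hC, hle⟩ := exists_norm_riemannXi_mul_gaussian_le ht0 s a b
    refine MertensBoundRH.integral_vertical_eq_of_tendsto F hab hFd.differentiableOn
      (integrable_riemannXi_mul_gaussian_vertical ht0 s a)
      (integrable_riemannXi_mul_gaussian_vertical ht0 s b) fun ε hε ↦ ?_
    -- decay: `C e^{−T²/(4|t|)} ≤ ε` for `|T| ≥ T₀`
    have hlim : Tendsto (fun T : ℝ ↦ C * Real.exp (-(T ^ 2 / (4 * |t|)))) atTop (𝓝 0) := by
      have : Tendsto (fun T : ℝ ↦ -(T ^ 2 / (4 * |t|))) atTop atBot := by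
        have h2 : Tendsto (fun T : ℝ ↦ T ^ 2 / (4 * |t|)) atTop atTop :=
          (tendsto_pow_atTop two_ne_zero).atTop_div_const (by positivity)
        exact tendsto_neg_atTop_atBot.comp h2
      simpa using (Real.tendsto_exp_atBot.comp this).const_mul C
    obtain ⟨T₀, hT₀⟩ := eventually_atTop.1 (hlim.eventually (gt_mem_nhds hε))
    refine ⟨max T₀ 0, fun σ hσ T hT ↦ ?_⟩
    have hT0 : 0 ≤ max T₀ 0 := le_max_right _ _
    have hsq : (max T₀ 0) ^ 2 ≤ T ^ 2 := by
      rw [← sq_abs T]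
      exact pow_le_pow_left₀ hT0 hT 2
    calc ‖F (σ + T * I)‖ ≤ C * Real.exp (-(T ^ 2 / (4 * |t|))) := hle σ hσ T
      _ ≤ C * Real.exp (-((max T₀ 0) ^ 2 / (4 * |t|))) := by
          refine mul_le_mul_of_nonneg_left (Real.exp_le_exp.2 ?_) hC.le
          have : (max T₀ 0) ^ 2 / (4 * |t|) ≤ T ^ 2 / (4 * |t|) :=
            div_le_div_of_nonneg_right hsq (by positivity)
          linarith
      _ ≤ ε := (hT₀ (max T₀ 0) (le_max_left _ _)).le
  -- step 3: assemble
  rw [h1]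
  congr 1
  have h2 : ∫ v : ℝ, F (s.re + v * I) = ∫ v : ℝ, F (2 + v * I) := by
    rcases le_total s.re 2 with h | h
    · simpa using hshift s.re 2 h
    · simpa using (hshift 2 s.re h).symm
  rw [h2]

/-! ## The integrals `B_{t,n}(s)` on the line `Re z = 2` -/

/-- Dobner's `B_{t,n}(s)` (eq. (4.1) of the source):
`B_{t,n}(s) = (1/(i√(π|t|))) ∫_{2−i∞}^{2+i∞} γ(z) e^{(J_t(s) − z)²/|t|} n^{−z} dz
 = (π|t|)^{-1/2} ∫_ℝ γ(2 + iv) n^{−(2+iv)} e^{(J_t(s) − 2 − iv)²/|t|} dv` (`z = 2 + iv`, `dz = i dv`). For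
`n = 0` the integrand, hence `B_{t,0}`, vanishes. [cite: Dobner2021, §4 eq. (4.1)] -/
def dobnerB (t : ℝ) (n : ℕ) (s : ℂ) : ℂ :=
  ((1 / Real.sqrt (Real.pi * |t|) : ℝ) : ℂ) *
    ∫ v : ℝ, xiGammaFactor (2 + v * I) * (n : ℂ) ^ (-(2 + v * I)) *
      Complex.exp (((1 / |t| : ℝ) : ℂ) * (dobnerJ t s - (2 + v * I)) ^ 2)

/-- The main term `γ_t(s) e^{−(|t|/4) log² n} n^{−s}` of Lemma 4 (i). [cite: Dobner2021, Lemma 4] -/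
def dobnerMainTerm (t : ℝ) (n : ℕ) (s : ℂ) : ℂ :=
  dobnerGammaT t s * Complex.exp (-(|t| / 4 * Real.log n ^ 2 : ℝ)) * (n : ℂ) ^ (-s)

/-- `B_{t,0}(s) = 0`. [folklore] -/
theorem dobnerB_zero (t : ℝ) (s : ℂ) : dobnerB t 0 s = 0 := by
  simp only [dobnerB, Nat.cast_zero]
  have : ∀ v : ℝ, (0 : ℂ) ^ (-(2 + v * I)) = 0 := fun v ↦
    Complex.zero_cpow (by intro h; have := congrArg Complex.re h; simp at this)
  simp_rw [this, mul_zero, zero_mul, MeasureTheory.integral_zero, mul_zero]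

/-! ## The series representation `ξ_t(J_t(s)) = Σ_n B_{t,n}(s)` -/

/-- The modulus of the Gaussian factor on the line `Re z = 2`:
`|e^{(J − 2 − iv)²/|t|}| = e^{((Re J − 2)² − (Im J − v)²)/|t|}`. [folklore] -/
theorem norm_cexp_dobner_gaussian (t : ℝ) (J : ℂ) (v : ℝ) :
    ‖Complex.exp (((1 / |t| : ℝ) : ℂ) * (J - (2 + v * I)) ^ 2)‖ =
      Real.exp (((J.re - 2) ^ 2 - (J.im - v) ^ 2) / |t|) := by
  rw [Complex.norm_exp]
  congr 1
  rw [Complex.re_ofReal_mul, sq, Complex.mul_re]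
  simp
  ring

/-- **`ξ_t(J_t(s)) = Σ_{n ≥ 1} B_{t,n}(s)` for every `s`** (§4 of the source, first display: on the
line `Re z = 2`, `ξ = γ ζ` and `ζ(z) = Σ n^{−z}` converges absolutely; the sum may be taken outside the
integral since `Σ_n ∫ |γ(2+iv)| n^{−2} |e^{(J−2−iv)²/|t|}| dv < ∞`). The `n = 0` term of the `tsum`
vanishes. [cite: Dobner2021, §4 (display before Lemma 4)] -/
theorem xiDeformed_dobnerJ_eq_tsum_dobnerB {t : ℝ} (ht : t < 0) (s : ℂ) :
    xiDeformed t (dobnerJ t s) = ∑' n : ℕ, dobnerB t n s := by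
  set J : ℂ := dobnerJ t s with hJdef
  have ht' : 0 < |t| := abs_pos.2 ht.ne
  set E : ℝ → ℂ := fun v ↦ Complex.exp (((1 / |t| : ℝ) : ℂ) * (J - (2 + v * I)) ^ 2) with hE
  set F : ℕ → ℝ → ℂ := fun n v ↦ xiGammaFactor (2 + v * I) * (n : ℂ) ^ (-(2 + v * I)) * E v with hF
  have h2re : ∀ v : ℝ, (2 + (v : ℂ) * I).re = 2 := fun v ↦ by simp
  -- pointwise: `ξ(2 + iv) E(v) = Σ_n F n v`
  have hpt : ∀ v : ℝ, riemannXi (2 + v * I) * E v = ∑' n : ℕ, F n v := by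
    intro v
    have hre : 1 < (2 + (v : ℂ) * I).re := by rw [h2re]; norm_num
    have hne1 : (2 + (v : ℂ) * I) ≠ 1 := fun h ↦ by
      have := congrArg Complex.re h; simp at this
    have hG : Gammaℝ (2 + v * I) ≠ 0 := Gammaℝ_ne_zero_of_re_pos (by rw [h2re]; norm_num)
    rw [← xiGammaFactor_mul_riemannZeta hne1 hG, zeta_eq_tsum_one_div_nat_cpow hre]
    simp only [hF]
    rw [mul_assoc, mul_comm (∑' n : ℕ, 1 / (n : ℂ) ^ (2 + v * I)) (E v), ← mul_assoc,
      ← tsum_mul_left]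
    refine tsum_congr fun n ↦ ?_
    rw [one_div, Complex.cpow_neg]
    ring
  -- domination `‖F n v‖ ≤ n^{-2} G(v)` with `G` integrable
  set M : ℝ := Real.pi ^ (-(2 : ℝ) / 2) * Real.Gamma ((2 : ℝ) / 2) with hM
  have hM0 : 0 ≤ M := mul_nonneg (Real.rpow_nonneg Real.pi_pos.le _) (Real.Gamma_pos_of_pos (by norm_num)).le
  set K : ℝ := 3 + |J.im| with hK
  set G : ℝ → ℝ := fun v ↦ M * Real.exp ((J.re - 2) ^ 2 / |t|) *
    ((K + |v - J.im|) ^ 2 * Real.exp (-((v - J.im) ^ 2 / |t|))) with hG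
  have hGint : Integrable G := by
    have h0 : Integrable fun u : ℝ ↦ (K + |u|) ^ 2 * Real.exp (-(u ^ 2 / |t|)) :=
      integrable_sq_mul_exp_neg_sq_div ht'
    have h1 := h0.comp_sub_right J.im
    exact h1.const_mul _
  have hnormF : ∀ n : ℕ, ∀ v : ℝ, ‖F n v‖ ≤ (n : ℝ) ^ (-2 : ℝ) * G v := by
    intro n v
    rcases Nat.eq_zero_or_pos n with rfl | hn
    · simp only [hF, Nat.cast_zero]
      have hne : (-(2 + (v : ℂ) * I)) ≠ 0 := by
        intro h; have := congrArg Complex.re h; simp at this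
      rw [Complex.zero_cpow hne, mul_zero, zero_mul, norm_zero, Real.zero_rpow (by norm_num), zero_mul]
    · simp only [hF, hE, norm_mul]
      rw [Complex.norm_natCast_cpow_of_pos hn, norm_cexp_dobner_gaussian]
      have e1 : (-(2 + (v : ℂ) * I)).re = -2 := by simp
      rw [e1]
      have hγ := norm_xiGammaFactor_vertical_le (J := 2) (by norm_num) v
      have hγ' : ‖xiGammaFactor (2 + v * I)‖ ≤ M * (K + |v - J.im|) ^ 2 := by
        refine hγ.trans ?_
        simp only [hM, Complex.re_ofNat, Complex.norm_ofNat]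
        refine mul_le_mul_of_nonneg_left ?_ hM0
        have : (2 : ℝ) + 1 + |v| ≤ K + |v - J.im| := by
          rw [hK]; linarith [abs_sub_abs_le_abs_sub v J.im]
        exact pow_le_pow_left₀ (by positivity) this 2
      have hexp : Real.exp (((J.re - 2) ^ 2 - (J.im - v) ^ 2) / |t|) =
          Real.exp ((J.re - 2) ^ 2 / |t|) * Real.exp (-((v - J.im) ^ 2 / |t|)) := by
        rw [← Real.exp_add]; congr 1; rw [show (J.im - v) ^ 2 = (v - J.im) ^ 2 by ring]; ring
      rw [hexp]
      have hnn : 0 ≤ (n : ℝ) ^ (-2 : ℝ) := Real.rpow_nonneg n.cast_nonneg _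
      calc ‖xiGammaFactor (2 + ↑v * I)‖ * (n : ℝ) ^ (-2 : ℝ) *
            (Real.exp ((J.re - 2) ^ 2 / |t|) * Real.exp (-((v - J.im) ^ 2 / |t|)))
          ≤ M * (K + |v - J.im|) ^ 2 * (n : ℝ) ^ (-2 : ℝ) *
            (Real.exp ((J.re - 2) ^ 2 / |t|) * Real.exp (-((v - J.im) ^ 2 / |t|))) := by
            gcongr
        _ = (n : ℝ) ^ (-2 : ℝ) * G v := by simp only [hG]; ring
  have hFc : ∀ n : ℕ, Continuous (F n) := by
    intro n
    simp only [hF, hE]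
    have hc := continuous_xiGammaFactor_vertical (J := 2) (by norm_num)
    have hcpow : Continuous fun v : ℝ ↦ (n : ℂ) ^ (-(2 + v * I)) := by
      rcases Nat.eq_zero_or_pos n with rfl | hn
      · have : (fun v : ℝ ↦ ((0 : ℕ) : ℂ) ^ (-(2 + v * I))) = fun _ ↦ 0 := by
          funext v
          rw [Nat.cast_zero, Complex.zero_cpow]
          intro h; have := congrArg Complex.re h; simp at this
        rw [this]; exact continuous_const
      · exact continuous_const.cpow (by fun_prop) fun v ↦ Or.inl (by exact_mod_cast hn)
    fun_prop
  have hFint : ∀ n : ℕ, Integrable (F n) := fun n ↦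
    (hGint.const_mul ((n : ℝ) ^ (-2 : ℝ))).mono' (hFc n).aestronglyMeasurable
      (Eventually.of_forall (hnormF n))
  have hFsum : Summable fun n : ℕ ↦ ∫ v, ‖F n v‖ := by
    refine Summable.of_nonneg_of_le (fun n ↦ integral_nonneg fun v ↦ norm_nonneg _)
      (fun n ↦ ?_) ((Real.summable_nat_rpow.2 (by norm_num : (-2 : ℝ) < -1)).mul_right (∫ v, G v))
    calc ∫ v, ‖F n v‖ ≤ ∫ v, (n : ℝ) ^ (-2 : ℝ) * G v :=
          integral_mono (hFint n).norm (hGint.const_mul _) (hnormF n)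
      _ = (n : ℝ) ^ (-2 : ℝ) * ∫ v, G v := integral_const_mul _ _
  -- assemble
  rw [xiDeformed_eq_integral_riemannXi_two ht J]
  simp_rw [show ∀ v : ℝ, riemannXi (2 + v * I) *
      Complex.exp (((1 / |t| : ℝ) : ℂ) * (J - (2 + v * I)) ^ 2) = ∑' n : ℕ, F n v from hpt]
  rw [← integral_tsum_of_summable_integral_norm hFint hFsum, ← tsum_mul_left]
  rfl

/-! ## Named fact: Lemma 4 -/

/-- NAMED FACT (**Dobner 2021, Lemma 4**, for `F = ζ`, i.e. `a_n = 1`; `t < 0` fixed). Let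
`C > 0`. For all `y = Im s` sufficiently large (depending on `C` and `t`) and `|Re s| ≤ C y^{1/4}`,
with `B_{t,n}(s) = Literature.dobnerB t n s` and the main term `γ_t(s) e^{−(|t|/4) log² n} n^{−s}`
(`Literature.NumberTheory.LFunctions.dobnerMainTerm`), there is a constant `K` (depending on `C`, `t`) such that for `n ≥ 1`:
(i) if `log n ≤ y^{1/3}/|t|`: `B_{t,n}(s) = γ_t(s) e^{−(|t|/4)log² n} n^{−s} (1 + O(y^{−1/5}))`, i.e.
`‖B_{t,n}(s) − main‖ ≤ K y^{−1/5} ‖main‖`; (ii) if `log n ≤ y^{3/5}/|t|`: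
`‖B_{t,n}(s)‖ ≤ K ‖γ_t(s)‖ e^{−(|t|/8) log² n} n^{−Re s}`; (iii) if `log n > y^{3/5}/|t|`:
`‖B_{t,n}(s)‖ ≤ K e^{−(|t|/10) log² n}`. (The source states the lemma uniformly for `|t| ≤ C`; it is
recorded here for each fixed `t < 0`, which is weaker. `B_{t,n}` is the source's integral on the
line `Re z = 2`, `Literature.NumberTheory.LFunctions.dobnerB`. Proved in §4 of the source by the method of steepest descent from
Stirling's formula, Lemmas 5–7.)
Users take `(h : dobner_lemma4)`. [cite: Dobner2021, Lemma 4] -/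
def dobner_lemma4 : Prop :=
  ∀ t : ℝ, t < 0 → ∀ C : ℝ, 0 < C → ∃ y₀ K : ℝ, 0 < K ∧ ∀ s : ℂ,
    |s.re| ≤ C * s.im ^ (1 / 4 : ℝ) → y₀ ≤ s.im → ∀ n : ℕ, 1 ≤ n →
      (Real.log n ≤ s.im ^ (1 / 3 : ℝ) / |t| →
        ‖dobnerB t n s - dobnerMainTerm t n s‖ ≤
          K * s.im ^ (-(1 / 5 : ℝ)) * ‖dobnerMainTerm t n s‖) ∧
      (Real.log n ≤ s.im ^ (3 / 5 : ℝ) / |t| →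
        ‖dobnerB t n s‖ ≤ K * ‖dobnerGammaT t s‖ * Real.exp (-(|t| / 8) * Real.log n ^ 2) *
          (n : ℝ) ^ (-s.re)) ∧
      (s.im ^ (3 / 5 : ℝ) / |t| < Real.log n →
        ‖dobnerB t n s‖ ≤ K * Real.exp (-(|t| / 10) * Real.log n ^ 2))

end Literature.NumberTheory.LFunctions

end
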